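import Mathlib
import Literature.Analysis.FluidPDE.Tao2016AveragedNS.SelfSimilarCascadeBlowup
import Literature.Analysis.FluidPDE.Tao2016AveragedNS.WeightedLatticeFlows
import Literature.Analysis.FluidPDE.Tao2016AveragedNS.ViscousLatticeFlows
import Literature.Analysis.FluidPDE.Tao2016AveragedNS.ViscousLatticeUniqueness
import Literature.Analysis.FluidPDE.Tao2016AveragedNS.ViscousEnvelopeSmoothing
import Summits.NavierStokesRegularity.NavierStokesRegularity.Theorems.WakeRatchetMinimalViscousBlowupMaximalBlowup
import HarnessLib

/-!
# The MAXIMAL EXACT (inviscid) cascade flow of a robustly blowing-up table and its blow-up time `T⋆`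
  — the physical-time trajectory that the extraction stub `stub_eternalFromBlowup` of K2(1)
  `TaoLadderRungTwoBreak.BlowupRigidityOne` (stmt-NavierStokesRegularity-20206) renormalises
  (`W_n(σ) = Λ^n e^{-σ} X_n(T⋆ - e^{-σ})`)

MODEL lattice ODEs only (Tao 2016 §4: the exact cascade (4.12) and its NS-scaled viscous form before
Theorem 4.2, tables of the comparable class `E₂(R)`); nothing here is a statement about the Navier–Stokes
equations, and NO item is closed (`--supports stmt-NavierStokesRegularity-20206`). Route-independent module
(no `Theses` import), like the WakeRatchet kit it extends.

Route WakeRatchet's `MinimalViscousBlowup.ThresholdRay.maximalBlowup` (stub S3a of crux ⟨22743⟩, file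
`WakeRatchetMinimalViscousBlowupMaximalBlowup`) constructs, for the `ν`-viscous lattice with `ν > 0` and
`m = 4`, from «no global regular solution» a MAXIMAL regular solution on some `[0,T⋆)` whose (4.5) norm is
unbounded. Its proof uses positivity of `ν` only through `ν ≥ 0` (the continuation criterion
`exists_viscousGlobal_of_apriori_bound` and the uniqueness theorem `viscousFlow_unique` are stated for
`ν ≥ 0`). This module records the `ν ≥ 0`, general-`m` form of that construction —
`maximalBlowup_of_nonneg_viscosity`, proof ADAPTED VERBATIM from `maximalBlowup` (same five steps: failure
of the a priori bound for every level, uniqueness on overlaps, no longest solution, `T⋆ := sup` of the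
existence times, gluing by choice at `σ(t) = (t+T⋆)/2`) — in order to reach the INVISCID lattice `ν = 0`,
and then feeds it with the hypothesis of the K2 cruxes:

* `maximalExactFlow_of_noGlobalCascade` — **robust blow-up (`NoGlobalCascade ε₀ α X₀`) ⇒ the EXACT
  cascade lattice from the one-shell datum `X₀` at shell `0` has a maximal solution `X` on `[0,T⋆)`,
  `0 < T⋆ < ∞`**: `C¹` on `[0,T⋆)`, the datum, no shells below `0`, the exact motion
  `∂ₜX_{i,n} = quadTerm_{i,n}(X)` on `[0,T⋆)`, (4.5)-regular on every `[0,T']`, `T' < T⋆`, and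
  `sup_{i,n} (1+(1+ε₀)^{10n})|X_{i,n}(t)|` UNBOUNDED on `[0,T⋆)` (κ-normal form
  `noGlobalCascade_iff_kappa` + `hasGlobal_of_viscousGlobal` at `ν = 0`, cf.
  `BlowupRigidityOne.not_viscousGlobal_of_noGlobalCascade` of the sibling module `…FiniteTimeBlowup`);
* `maximalViscousFlow_of_noGlobalCascade` — the same for every viscosity `0 ≤ ν ≤ κ/√2`.

What is NOT here: the blow-up RATE (type I in self-similar variables), compactness modulo shell shift,
survival in the limit — the open content of the extraction stub.
-/

noncomputable section

-- the summit and its single sub-problem share the name (CONVENTIONS §1)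
set_option linter.dupNamespace false

open Set Filter Topology

namespace Summit.NavierStokesRegularity.NavierStokesRegularity.Theorems

namespace BlowupRigidityOne

open Literature.Analysis.FluidPDE Literature.Analysis.FluidPDE.TaoCascade
open MinimalViscousBlowup.ThresholdRay (aprioriWeight_le_weight45 hasDerivWithinAt_Ici_of_Icc
  hasDerivWithinAt_congr_Ici quadTerm_congr_at contDiffOn_one_Ico_of_hasDerivWithinAt)

variable {m : ℕ}

/-- **MAXIMAL SOLUTION AND BLOW-UP ALTERNATIVE for the `ν`-viscous lattice, `ν ≥ 0`, general `m`**
(adapted verbatim from route WakeRatchet's `MinimalViscousBlowup.ThresholdRay.maximalBlowup`, which is the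
case `ν > 0`, `m = 4`): if the NS-scaled `ν`-viscous cascade lattice of a table `α ∈ E₂(R)` has NO global
regular solution from the one-shell datum `X₀` (`¬ ∃ X, ViscousGlobal ε₀ ν α X₀ X`), then it has a maximal
regular solution `X` on some `[0,T)`, `0 < T`: `C¹` on `[0,T)`, the datum, no shells below `0`, the motion
`∂ₜX_{i,n} = quadTerm_{i,n}(X) − ν(1+ε₀)^{2n}X_{i,n}` on `[0,T)` (derivative within `[0,∞)`),
(4.5)-regular on every `[0,T']`, `T' < T`, and with UNBOUNDED (4.5)-weighted norm on `[0,T)`.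
[cite: Tao2016AveragedNS, §4 (the exact lattice (4.12) and the viscous lattice before Thm. 4.2; Lemma 4.1 (4.5), (4.7), (4.11)); Teschl2012, §2.6 Cor. 2.16 (maximal solutions)] -/
theorem maximalBlowup_of_nonneg_viscosity {ε₀ R ν : ℝ} (hε : 0 < ε₀)
    {α : Fin m → Fin m → Fin m → ℤ × ℤ × ℤ → ℝ} {X₀ : Fin m → ℝ} (hα : InTableClass R α)
    (hν : 0 ≤ ν) (hno : ¬ ∃ X : Fin m → ℤ → ℝ → ℝ, ViscousGlobal ε₀ ν α X₀ X) :
    ∃ (T : ℝ) (X : Fin m → ℤ → ℝ → ℝ), 0 < T ∧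
      (∀ i n, ContDiffOn ℝ 1 (X i n) (Set.Ico 0 T)) ∧
      (∀ i n, X i n 0 = if n = 0 then X₀ i else 0) ∧
      (∀ i n t, n < 0 → X i n t = 0) ∧
      (∀ i n t, 0 ≤ t → t < T → derivWithin (X i n) (Set.Ici 0) t =
        quadTerm ε₀ α X i n t - ν * (1 + ε₀) ^ ((2 : ℝ) * n) * X i n t) ∧
      (∀ T' : ℝ, 0 < T' → T' < T → ∃ M : ℝ, ∀ t : ℝ, 0 ≤ t → t ≤ T' →
        ∀ (i : Fin m) (n : ℤ), (1 + (1 + ε₀) ^ ((10 : ℝ) * n)) * |X i n t| ≤ M) ∧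
      (∀ M : ℝ, ∃ t : ℝ, 0 ≤ t ∧ t < T ∧
        ∃ (i : Fin m) (n : ℤ), M < (1 + (1 + ε₀) ^ ((10 : ℝ) * n)) * |X i n t|) := by
  have hε0 : 0 ≤ ε₀ := hε.le
  have hl0 : (0 : ℝ) < 1 + ε₀ := by linarith
  -- the weight, the table
  set w : ℤ → ℝ := fun k => (1 + ε₀) ^ ((10 : ℝ) * ((max k 0 : ℤ) : ℝ)) with hw
  have hwpos : ∀ k, 0 < w k := fun k => Real.rpow_pos_of_pos hl0 _
  have hW := weightRatiosLE_aprioriWeight hε0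
  have hD : ∀ k : ℤ, (1 + (1 + ε₀) ^ ((10 : ℝ) * k)) / w k ≤ 2 := fun k => aprioriWeight_dominates hε0 k
  have hH3 : ∀ k : ℤ, w k ≤ 1 + (1 + ε₀) ^ ((10 : ℝ) * k) := fun k => aprioriWeight_le_weight45 hε0 k
  set α' := restrictShiftSet α with hα'def
  have hα' : ∀ i₁ i₂ i₃ μ, |α' i₁ i₂ i₃ μ| ≤ 1 :=
    abs_restrictShiftSet_le zero_le_one (abs_le_one_of_inTableClass hα)
  -- regular solutions on windows `[0,s]` (the shape delivered by the continuation criterion)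
  set Sol : ℝ → (Fin m → ℤ → ℝ → ℝ) → Prop := fun s X =>
    (∀ i k, X i k 0 = if k = 0 then X₀ i else 0) ∧ (∀ i k, k < 0 → ∀ t, X i k t = 0) ∧
    (∃ M : ℝ, ∀ (t : ℝ) (i : Fin m) (k : ℤ), w k * |X i k t| ≤ M) ∧ (∀ i k, Continuous (X i k)) ∧
    (∀ i k, ∀ t ∈ Icc 0 s, HasDerivWithinAt (X i k)
      (quadTerm ε₀ α' X i k t - ν * (1 + ε₀) ^ ((2 : ℝ) * k) * X i k t) (Icc 0 s) t) with hSol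
  -- STEP 1: failure of the a priori bound on some horizon, for every level `B`
  have hno' : ¬ ∃ X : Fin m → ℤ → ℝ → ℝ, ViscousGlobal ε₀ ν α' X₀ X :=
    fun ⟨X, hX⟩ => hno ⟨X, hX.of_restrictShiftSet⟩
  have hfail : ∃ T : ℝ, 0 < T ∧ ∀ B : ℝ, ∃ s ∈ Ioc 0 T, ∃ X : Fin m → ℤ → ℝ → ℝ,
      Sol s X ∧ ∃ t ∈ Icc 0 s, ∃ (i : Fin m) (k : ℤ), B < w k * |X i k t| := by
    by_contra hcon
    apply hno'
    refine exists_viscousGlobal_of_apriori_bound hl0.le hW zero_le_one hα' (D := 2) hD hν X₀ fun T hT => ?_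
    by_contra hB
    apply hcon
    refine ⟨T, hT, fun B => ?_⟩
    by_contra hB'
    apply hB
    refine ⟨B, fun s hs X h1 h2 h3 h4 h5 t ht i k => ?_⟩
    by_contra hlt
    exact hB' ⟨s, hs, X, ⟨h1, h2, h3, h4, h5⟩, t, ht, i, k, not_le.1 hlt⟩
  obtain ⟨T, hT, hfailB⟩ := hfail
  -- STEP 2: uniqueness on overlaps; restriction
  have hU : ∀ s s' X Y, Sol s X → Sol s' Y → ∀ t ∈ Icc 0 (min s s'), ∀ i k, X i k t = Y i k t := by
    intro s s' X Y hX hY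
    obtain ⟨hX1, -, ⟨MX, hMX⟩, -, hXd⟩ := hX
    obtain ⟨hY1, -, ⟨MY, hMY⟩, -, hYd⟩ := hY
    refine viscousFlow_unique hl0.le hW zero_le_one hα' hν (B := max MX MY)
      (fun i k => by rw [hX1, hY1]) (fun t _ i k => (hMX t i k).trans (le_max_left _ _))
      (fun t _ i k => (hMY t i k).trans (le_max_right _ _)) (fun i k t ht => ?_) (fun i k t ht => ?_)
    · exact (hXd i k t ⟨ht.1, ht.2.trans (min_le_left _ _)⟩).mono (Icc_subset_Icc_right (min_le_left _ _))
    · exact (hYd i k t ⟨ht.1, ht.2.trans (min_le_right _ _)⟩).mono (Icc_subset_Icc_right (min_le_right _ _))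
  have hmono : ∀ s s' X, Sol s X → s' ≤ s → Sol s' X := by
    rintro s s' X ⟨h1, h2, h3, h4, h5⟩ hss'
    exact ⟨h1, h2, h3, h4, fun i k t ht => (h5 i k t ⟨ht.1, ht.2.trans hss'⟩).mono (Icc_subset_Icc_right hss')⟩
  -- STEP 3: every solution is beaten by a strictly longer one
  have hkey : ∀ s X, Sol s X → ∃ s₁ X₁, s < s₁ ∧ s₁ ≤ T ∧ Sol s₁ X₁ := by
    intro s X hX
    obtain ⟨M, hM⟩ := hX.2.2.1
    obtain ⟨s₁, hs₁, X₁, hX₁, t₁, ht₁, i, k, hlt⟩ := hfailB M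
    refine ⟨s₁, X₁, ?_, hs₁.2, hX₁⟩
    by_contra hle
    have hle : s₁ ≤ s := not_lt.1 hle
    have heq := hU s₁ s X₁ X hX₁ hX t₁ ⟨ht₁.1, by rw [min_eq_left hle]; exact ht₁.2⟩ i k
    rw [heq] at hlt
    exact absurd (hM t₁ i k) (not_le.2 hlt)
  set 𝒮 : Set ℝ := {s | 0 < s ∧ ∃ X, Sol s X} with h𝒮
  have hne : 𝒮.Nonempty := by
    obtain ⟨s, hs, X, hX, -⟩ := hfailB 0
    exact ⟨s, hs.1, X, hX⟩
  have hbdd : BddAbove 𝒮 := by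
    refine ⟨T, fun s hs => ?_⟩
    obtain ⟨-, X, hX⟩ := hs
    obtain ⟨s₁, X₁, h1, h2, -⟩ := hkey s X hX
    linarith
  set Ts : ℝ := sSup 𝒮 with hTs
  have hTs0 : 0 < Ts := by
    obtain ⟨s, hs⟩ := hne
    exact lt_of_lt_of_le hs.1 (le_csSup hbdd hs)
  have hlt_of_sol : ∀ s X, Sol s X → s < Ts := by
    intro s X hX
    obtain ⟨s₁, X₁, h1, -, hX₁⟩ := hkey s X hX
    rcases le_or_gt s₁ 0 with hs₁ | hs₁
    · linarith
    · exact lt_of_lt_of_le h1 (le_csSup hbdd ⟨hs₁, X₁, hX₁⟩)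
  have hpiece : ∀ s, 0 < s → s < Ts → ∃ X, Sol s X := by
    intro s hs0 hs
    obtain ⟨s', hs', hss'⟩ := exists_lt_of_lt_csSup hne hs
    obtain ⟨-, X, hX⟩ := hs'
    exact ⟨X, hmono s' s X hX hss'.le⟩
  -- STEP 4: glue by choice at `σ(t) = (t + T⋆)/2`
  choose P hP using hpiece
  have hσ : ∀ t : ℝ, 0 ≤ t → t < Ts → 0 < (t + Ts) / 2 ∧ (t + Ts) / 2 < Ts ∧ t < (t + Ts) / 2 :=
    fun t h0 h1 => ⟨by linarith, by linarith, by linarith⟩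
  set Xg : Fin m → ℤ → ℝ → ℝ := fun i k t =>
    if h : 0 ≤ t ∧ t < Ts then P ((t + Ts) / 2) (hσ t h.1 h.2).1 (hσ t h.1 h.2).2.1 i k t else 0 with hXg
  -- agreement with every solution on its window
  have hagree : ∀ s Y, Sol s Y → ∀ t, 0 ≤ t → t < Ts → t ≤ s → ∀ i k, Xg i k t = Y i k t := by
    intro s Y hY t ht0 htT hts i k
    have hd : 0 ≤ t ∧ t < Ts := ⟨ht0, htT⟩
    simp only [hXg, dif_pos hd]
    exact hU _ s _ Y (hP _ _ _) hY t ⟨ht0, le_min (hσ t ht0 htT).2.2.le hts⟩ i k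
  -- the derivative of the glued family within `Ici 0`
  have hDer : ∀ i n t, 0 ≤ t → t < Ts → HasDerivWithinAt (Xg i n)
      (quadTerm ε₀ α Xg i n t - ν * (1 + ε₀) ^ ((2 : ℝ) * n) * Xg i n t) (Ici 0) t := by
    intro i n t ht0 htT
    obtain ⟨hs0, hsT, hts⟩ := hσ t ht0 htT
    set s : ℝ := (t + Ts) / 2 with hsdef
    have hY := hP s hs0 hsT
    set Y := P s hs0 hsT with hYdef
    have h1 : HasDerivWithinAt (Y i n) (quadTerm ε₀ α' Y i n t - ν * (1 + ε₀) ^ ((2 : ℝ) * n) * Y i n t) (Ici 0) t :=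
      hasDerivWithinAt_Ici_of_Icc hts (hY.2.2.2.2 i n t ⟨ht0, hts.le⟩)
    have hag : ∀ x, 0 ≤ x → x < min s Ts → Xg i n x = Y i n x := fun x hx0 hx =>
      hagree s Y hY x hx0 (lt_of_lt_of_le hx (min_le_right _ _)) (le_of_lt (lt_of_lt_of_le hx (min_le_left _ _))) i n
    have h2 := hasDerivWithinAt_congr_Ici ht0 (lt_min hts htT) hag h1
    have hat : ∀ j k, Y j k t = Xg j k t := fun j k => (hagree s Y hY t ht0 htT hts.le j k).symm
    rw [quadTerm_congr_at hat, hat i n, hα'def, quadTerm_restrictShiftSet] at h2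
    exact h2
  -- STEP 5: the six clauses
  refine ⟨Ts, Xg, hTs0, fun i n => ?_, fun i n => ?_, fun i n t hn => ?_, fun i n t ht htT => ?_, fun T' hT'0 hT' => ?_, fun M₀ => ?_⟩
  · -- (i) `C¹` on `[0, T⋆)`
    have hXc : ∀ j k, ContinuousOn (Xg j k) (Ico 0 Ts) := fun j k t ht =>
      ((hDer j k t ht.1 ht.2).mono Ico_subset_Ici_self).continuousWithinAt
    refine contDiffOn_one_Ico_of_hasDerivWithinAt (fun t ht => (hDer i n t ht.1 ht.2).mono Ico_subset_Ici_self) ?_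
    have hq : ContinuousOn (fun t => quadTerm ε₀ α Xg i n t) (Ico 0 Ts) := by
      unfold quadTerm
      refine continuousOn_finsetSum _ fun i₁ _ => continuousOn_finsetSum _ fun i₂ _ =>
        continuousOn_finsetSum _ fun μ _ => ?_
      exact continuousOn_const.mul ((hXc _ _).mul (hXc _ _))
    exact hq.sub (continuousOn_const.mul (hXc i n))
  · -- (ii) the datum
    obtain ⟨hs0, hsT, hts⟩ := hσ 0 le_rfl hTs0
    rw [hagree _ _ (hP _ hs0 hsT) 0 le_rfl hTs0 hts.le i n]
    exact (hP _ hs0 hsT).1 i n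
  · -- (iii) no shells below `0`
    by_cases h : 0 ≤ t ∧ t < Ts
    · simp only [hXg, dif_pos h]
      exact (hP _ _ _).2.1 i n hn t
    · simp only [hXg, dif_neg h]
  · -- (iv) the viscous motion
    exact (hDer i n t ht htT).derivWithin (uniqueDiffOn_Ici 0 t ht)
  · -- (v) (4.5)-regular on `[0, T']`
    obtain ⟨hs0, hsT, hts⟩ := hσ T' hT'0.le hT'
    have hY := hP _ hs0 hsT
    obtain ⟨M, hM⟩ := hY.2.2.1
    refine ⟨2 * M, fun t ht0 htT' i n => ?_⟩
    rw [hagree _ _ hY t ht0 (lt_of_le_of_lt htT' hT') (htT'.trans hts.le) i n]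
    have h1 : 1 + (1 + ε₀) ^ ((10 : ℝ) * n) ≤ 2 * w n := by
      have := hD n
      rwa [div_le_iff₀ (hwpos n)] at this
    calc (1 + (1 + ε₀) ^ ((10 : ℝ) * n)) * |P _ hs0 hsT i n t|
        ≤ 2 * w n * |P _ hs0 hsT i n t| := mul_le_mul_of_nonneg_right h1 (abs_nonneg _)
      _ = 2 * (w n * |P _ hs0 hsT i n t|) := by ring
      _ ≤ 2 * M := by linarith [hM t i n]
  · -- (vi) the weighted norm is unbounded on `[0, T⋆)`
    obtain ⟨s₁, hs₁, X₁, hX₁, t₁, ht₁, i, k, hlt⟩ := hfailB M₀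
    have hs₁T : s₁ < Ts := hlt_of_sol s₁ X₁ hX₁
    have ht₁T : t₁ < Ts := lt_of_le_of_lt ht₁.2 hs₁T
    refine ⟨t₁, ht₁.1, ht₁T, i, k, ?_⟩
    rw [hagree s₁ X₁ hX₁ t₁ ht₁.1 ht₁T ht₁.2 i k]
    exact lt_of_lt_of_le hlt (mul_le_mul_of_nonneg_right (hH3 k) (abs_nonneg _))

/-- **ROBUST BLOW-UP ⇒ A MAXIMAL `ν`-VISCOUS FLOW BLOWING UP IN THE (4.5) NORM, for every
`0 ≤ ν ≤ κ/√2`** (`α ∈ E₂(R)`, any `m`): `NoGlobalCascade ε₀ α X₀` forbids global regular `ν`-viscous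
solutions at small viscosity (`not_viscousGlobal_of_noGlobalCascade`), and
`maximalBlowup_of_nonneg_viscosity` supplies the maximal solution with its finite blow-up time.
[cite: Tao2016AveragedNS, §4 Thm. 4.2 and the viscous lattice before Thm. 4.2; Teschl2012, §2.6 Cor. 2.16] -/
theorem maximalViscousFlow_of_noGlobalCascade {ε₀ R : ℝ} (hε : 0 < ε₀)
    {α : Fin m → Fin m → Fin m → ℤ × ℤ × ℤ → ℝ} {X₀ : Fin m → ℝ} (hα : InTableClass R α)
    (hNG : NoGlobalCascade ε₀ α X₀) :
    ∃ κ : ℝ, 0 < κ ∧ ∀ ν : ℝ, 0 ≤ ν → ν * Real.sqrt 2 ≤ κ →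
      ∃ (T : ℝ) (X : Fin m → ℤ → ℝ → ℝ), 0 < T ∧
        (∀ i n, ContDiffOn ℝ 1 (X i n) (Set.Ico 0 T)) ∧
        (∀ i n, X i n 0 = if n = 0 then X₀ i else 0) ∧
        (∀ i n t, n < 0 → X i n t = 0) ∧
        (∀ i n t, 0 ≤ t → t < T → derivWithin (X i n) (Set.Ici 0) t =
          quadTerm ε₀ α X i n t - ν * (1 + ε₀) ^ ((2 : ℝ) * n) * X i n t) ∧
        (∀ T' : ℝ, 0 < T' → T' < T → ∃ M : ℝ, ∀ t : ℝ, 0 ≤ t → t ≤ T' →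
          ∀ (i : Fin m) (n : ℤ), (1 + (1 + ε₀) ^ ((10 : ℝ) * n)) * |X i n t| ≤ M) ∧
        (∀ M : ℝ, ∃ t : ℝ, 0 ≤ t ∧ t < T ∧
          ∃ (i : Fin m) (n : ℤ), M < (1 + (1 + ε₀) ^ ((10 : ℝ) * n)) * |X i n t|) := by
  -- κ-normal form: some defect budget `κ > 0` admits no global pseudo-solution from shell `0`; a global
  -- regular `ν`-viscous solution would be a global `(ν√2, 0)`-pseudo-solution (as in
  -- `BlowupRigidityOne.not_viscousGlobal_of_noGlobalCascade`, re-derived here to keep this module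
  -- independent of the route file)
  obtain ⟨κ, hκ, hno⟩ := (noGlobalCascade_iff_kappa hε).1 hNG
  refine ⟨κ, hκ, fun ν hν hνκ => maximalBlowup_of_nonneg_viscosity hε hα hν ?_⟩
  rintro ⟨X, hX⟩
  exact hno (hasGlobal_mono hε.le (hasGlobal_of_viscousGlobal hε hν hX) hνκ hκ.le)

/-- **ROBUST BLOW-UP ⇒ THE MAXIMAL EXACT CASCADE FLOW AND ITS BLOW-UP TIME `T⋆`.** If
`NoGlobalCascade ε₀ α X₀` (`ε₀ > 0`, `α ∈ E₂(R)`, any `m`), then the EXACT (inviscid) cascade lattice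
`∂ₜX_{i,n} = quadTerm_{i,n}(X)` from the one-shell datum `X₀` at shell `0` has a maximal solution `X` on
some `[0,T⋆)`, `0 < T⋆ < ∞`: `C¹` on `[0,T⋆)`, the datum, no shells below `0`, the exact motion on
`[0,T⋆)`, (4.5)-regular on every `[0,T']`, `T' < T⋆`, and `sup_{i,n}(1+(1+ε₀)^{10n})|X_{i,n}(t)|`
UNBOUNDED as `t ↑ T⋆`. This is the trajectory whose self-similar renormalisation around `T⋆` the
extraction stub of K2(1) (= `∀ R ≥ 1, EternalRigidityFwd R 1`) takes an ω-limit of.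
[cite: Tao2016AveragedNS, §4 Thm. 4.2 and (4.12), Lemma 4.1 (4.5), (4.7), (4.11); Teschl2012, §2.6 Cor. 2.16] -/
theorem maximalExactFlow_of_noGlobalCascade {ε₀ R : ℝ} (hε : 0 < ε₀)
    {α : Fin m → Fin m → Fin m → ℤ × ℤ × ℤ → ℝ} {X₀ : Fin m → ℝ} (hα : InTableClass R α)
    (hNG : NoGlobalCascade ε₀ α X₀) :
    ∃ (T : ℝ) (X : Fin m → ℤ → ℝ → ℝ), 0 < T ∧
      (∀ i n, ContDiffOn ℝ 1 (X i n) (Set.Ico 0 T)) ∧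
      (∀ i n, X i n 0 = if n = 0 then X₀ i else 0) ∧
      (∀ i n t, n < 0 → X i n t = 0) ∧
      (∀ i n t, 0 ≤ t → t < T → derivWithin (X i n) (Set.Ici 0) t = quadTerm ε₀ α X i n t) ∧
      (∀ T' : ℝ, 0 < T' → T' < T → ∃ M : ℝ, ∀ t : ℝ, 0 ≤ t → t ≤ T' →
        ∀ (i : Fin m) (n : ℤ), (1 + (1 + ε₀) ^ ((10 : ℝ) * n)) * |X i n t| ≤ M) ∧
      (∀ M : ℝ, ∃ t : ℝ, 0 ≤ t ∧ t < T ∧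
        ∃ (i : Fin m) (n : ℤ), M < (1 + (1 + ε₀) ^ ((10 : ℝ) * n)) * |X i n t|) := by
  obtain ⟨κ, hκ, H⟩ := maximalViscousFlow_of_noGlobalCascade hε hα hNG
  obtain ⟨T, X, hT, h1, h2, h3, h4, h5, h6⟩ := H 0 le_rfl (by rw [zero_mul]; exact hκ.le)
  refine ⟨T, X, hT, h1, h2, h3, fun i n t ht htT => ?_, h5, h6⟩
  rw [h4 i n t ht htT, zero_mul, zero_mul, sub_zero]

end BlowupRigidityOne

end Summit.NavierStokesRegularity.NavierStokesRegularity.Theorems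

end
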